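import Summits.ValiantsHypothesis.ValiantsHypothesis.Theses.BarrierLever
import Summits.ValiantsHypothesis.ValiantsHypothesis.Theorems.BarrierLeverChainCertificateSufficesItem

/-!
# Route BarrierLever — item `ChainCertificateSuffices` (stmt-ValiantsHypothesis-19651): the link

Closing link (`--workitem stmt-ValiantsHypothesis-19651`; cell valiant-natproofs, rung V4; prover
seat val-np-p1). The proof is `ChainCert.chainCertificateSuffices_item`
(`Theorems/BarrierLeverChainCertificateSufficesItem.lean`, item signature verbatim, built on the
three `…ChainCertificateSuffices{Cycle,Blocks,}.lean` files); this file only restates it with the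
route declaration `Theses.BarrierLever.ChainCertificateSuffices` as its type, so that the gate's
type-match closes the item (this module imports the route file, hence no `_holds` link there).

WHAT THIS IS NOT: a reduction only (chain certificate ⇒ UT-D certificate, layout-wise); its
supplier `ChainCertificatesExist` (stmt-19652) is a conjecture; nothing on UT-D / TT / TNS /
item 19717 in general, crux stmt-ValiantsHypothesis-14610, or `VP` versus `VNP`.
-/

-- layout Summits/ValiantsHypothesis/ValiantsHypothesis forces the duplicated namespace component
set_option linter.dupNamespace false

namespace Summit.ValiantsHypothesis.ValiantsHypothesis.Theorems.BarrierLever.ChainCert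

/-- **Item stmt-ValiantsHypothesis-19651 `ChainCertificateSuffices` holds** (typed by the route
declaration; proof `chainCertificateSuffices_item`). -/
theorem chainCertificateSuffices_route :
    Summit.ValiantsHypothesis.ValiantsHypothesis.Theses.BarrierLever.ChainCertificateSuffices :=
  chainCertificateSuffices_item

end Summit.ValiantsHypothesis.ValiantsHypothesis.Theorems.BarrierLever.ChainCert
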